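import Literature.Probability.RandomPlanarGeometry.HexSAWPolygonCells
import HarnessLib

/-!
# Cell calculus for honeycomb polygon surgery, XVI: the 3-chain base `C₂ ↦ F₂` (the `N = 14 → 16` seed of «OMEGA»)

Topic `Literature/Probability/RandomPlanarGeometry` (lane «pcv-sawmu», a-p4 g21; sequel of `HexSAWPolygonCells.lean`).

The one exceptional base of the step-two injection «OMEGA» (`HOME/pub-sawmu-a-p4/g21/omega/THEOREM-OMEGA-g21.md` §2): the up-right 3-chain
`C₂ = {p, UR p, UR² p}` (perimeter 14) is sent to `F₂ = {p, R p, UR p, UL (UR p)}` (perimeter 16), with port `UR (UL (UR p))` for the top.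
This file computes both perimeters from the insertion law of part I (`perim_chain3 = 14`, `perim_F2 = 16`) and shows the port is a clean leaf
spot of `F₂` (`card_contacts_portF2`).  All contact counts are coordinate arithmetic.

Sources: N. Madras, G. Slade, *The Self-Avoiding Walk* (1993), §3.2, proof of Theorem 3.2.3 [MadrasSlade1993]; I. Jensen, J. Phys.: Conf.
Ser. 42 (2006) 163, §2 [Jensen2006HoneycombPolygons].  Label (lane): LANE INFRASTRUCTURE; nothing new in writing.
-/

open Finset

namespace Literature.Probability.RandomPlanarGeometry.SAW

namespace HexCell

/-- A contact count on an explicit set: if the hexagons of `W` adjacent to `c` are exactly `{d}`, the count is `1`.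
[cite: MadrasSlade1993, §3.2 (proof of Theorem 3.2.3)] -/
theorem card_contacts_eq_one_of {W : Finset Cell} {c d : Cell} (hd : d ∈ W) (hdc : d ∈ nbrs c)
    (h : ∀ e ∈ W, e ∈ nbrs c → e = d) : #(nbrs c ∩ W) = 1 := by
  rw [card_eq_one]
  refine ⟨d, ?_⟩
  ext e
  simp only [mem_inter, mem_singleton]
  exact ⟨fun ⟨h1, h2⟩ => h e h2 h1, fun he => by subst he; exact ⟨hdc, hd⟩⟩

/-- … and if they are exactly `{d, d'}` with `d ≠ d'`, the count is `2`. [cite: MadrasSlade1993, §3.2 (proof of Theorem 3.2.3)] -/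
theorem card_contacts_eq_two_of {W : Finset Cell} {c d d' : Cell} (hd : d ∈ W) (hdc : d ∈ nbrs c) (hd' : d' ∈ W)
    (hdc' : d' ∈ nbrs c) (hne : d ≠ d') (h : ∀ e ∈ W, e ∈ nbrs c → e = d ∨ e = d') : #(nbrs c ∩ W) = 2 := by
  rw [card_eq_two]
  refine ⟨d, d', hne, ?_⟩
  ext e
  simp only [mem_inter, mem_insert, mem_singleton]
  constructor
  · rintro ⟨h1, h2⟩; exact h e h2 h1
  · rintro (rfl | rfl)
    · exact ⟨hdc, hd⟩
    · exact ⟨hdc', hd'⟩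

/-- ★ `perim C₂ = 14` for the up-right 3-chain `{UR² p, UR p, p}`. [cite: Jensen2006HoneycombPolygons, §2 (the smallest honeycomb polygons)] -/
theorem perim_chain3 (p : Cell) : perim ({UR (UR p), UR p, p} : Finset Cell) = 14 := by
  classical
  obtain ⟨a, b⟩ := p
  have h1n : UR (a, b) ∉ ({(a, b)} : Finset Cell) := by
    simp only [mem_singleton, Prod.ext_iff, UR_fst, UR_snd]; omega
  have h1c : #(nbrs (UR (a, b)) ∩ {(a, b)}) = 1 :=
    card_contacts_eq_one_of (d := (a, b)) (mem_singleton_self _) (by simp only [mem_nbrs_iff, Prod.ext_iff, UR_fst, UR_snd]; omega)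
      (fun e he _ => mem_singleton.1 he)
  have h2n : UR (UR (a, b)) ∉ ({UR (a, b), (a, b)} : Finset Cell) := by
    simp only [mem_insert, mem_singleton, Prod.ext_iff, UR_fst, UR_snd]; omega
  have h2c : #(nbrs (UR (UR (a, b))) ∩ {UR (a, b), (a, b)}) = 1 := by
    refine card_contacts_eq_one_of (d := UR (a, b)) (by simp) (by simp only [mem_nbrs_iff, Prod.ext_iff, UR_fst, UR_snd]; omega) ?_
    intro e he hen
    simp only [mem_insert, mem_singleton] at he
    rcases he with rfl | rfl
    · rfl
    · exfalso; simp only [mem_nbrs_iff, Prod.ext_iff, UR_fst, UR_snd] at hen; omega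
  rw [show ({UR (UR (a, b)), UR (a, b), (a, b)} : Finset Cell) = insert (UR (UR (a, b))) {UR (a, b), (a, b)} from rfl,
    perim_insert_of_contacts_eq_one h2n h2c, show ({UR (a, b), (a, b)} : Finset Cell) = insert (UR (a, b)) {(a, b)} from rfl,
    perim_insert_of_contacts_eq_one h1n h1c, perim_singleton]

/-- ★ `perim F₂ = 16` for `F₂ = {UL (UR p), UR p, R p, p}` — so `C₂ ↦ F₂` is a `+2` move. [cite: MadrasSlade1993, §3.2, Theorem 3.2.3 (3.2.3)] -/
theorem perim_F2 (p : Cell) : perim ({UL (UR p), UR p, R p, p} : Finset Cell) = 16 := by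
  classical
  obtain ⟨a, b⟩ := p
  -- step 1: `R p` on `{p}`: one contact
  have h1n : R (a, b) ∉ ({(a, b)} : Finset Cell) := by
    simp only [mem_singleton, Prod.ext_iff, R_fst, R_snd]; omega
  have h1c : #(nbrs (R (a, b)) ∩ {(a, b)}) = 1 :=
    card_contacts_eq_one_of (d := (a, b)) (mem_singleton_self _)
      (mem_nbrs_iff.2 (by right; right; right; right; right; ext <;> simp)) (fun e he _ => mem_singleton.1 he)
  -- step 2: `UR p` on `{R p, p}`: two contacts
  have h2n : UR (a, b) ∉ ({R (a, b), (a, b)} : Finset Cell) := by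
    simp only [mem_insert, mem_singleton, Prod.ext_iff, UR_fst, UR_snd, R_fst, R_snd]; omega
  have h2c : #(nbrs (UR (a, b)) ∩ {R (a, b), (a, b)}) = 2 := by
    refine card_contacts_eq_two_of (d := R (a, b)) (d' := (a, b)) (by simp)
      (by simp only [mem_nbrs_iff, Prod.ext_iff, UR_fst, UR_snd, R_fst, R_snd]; omega)
      (by simp) (by simp only [mem_nbrs_iff, Prod.ext_iff, UR_fst, UR_snd]; omega)
      (by intro h; have := congrArg Prod.fst h; simp at this) ?_
    intro e he _
    simp only [mem_insert, mem_singleton] at he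
    exact he
  -- step 3: `UL (UR p)` on `{UR p, R p, p}`: one contact
  have h3n : UL (UR (a, b)) ∉ ({UR (a, b), R (a, b), (a, b)} : Finset Cell) := by
    simp only [mem_insert, mem_singleton, Prod.ext_iff, UR_fst, UR_snd, UL_fst, UL_snd, R_fst, R_snd]; omega
  have h3c : #(nbrs (UL (UR (a, b))) ∩ {UR (a, b), R (a, b), (a, b)}) = 1 := by
    refine card_contacts_eq_one_of (d := UR (a, b)) (by simp)
      (by simp only [mem_nbrs_iff, Prod.ext_iff, UR_fst, UR_snd, UL_fst, UL_snd]; omega) ?_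
    intro e he hen
    simp only [mem_insert, mem_singleton] at he
    simp only [mem_nbrs_iff, Prod.ext_iff, UL_fst, UL_snd, UR_fst, UR_snd] at hen
    rcases he with rfl | rfl | rfl
    · rfl
    · exfalso; simp only [R_fst, R_snd] at hen; omega
    · exfalso; omega
  rw [show ({UL (UR (a, b)), UR (a, b), R (a, b), (a, b)} : Finset Cell) = insert (UL (UR (a, b))) {UR (a, b), R (a, b), (a, b)} from rfl,
    perim_insert_of_contacts_eq_one h3n h3c,
    show ({UR (a, b), R (a, b), (a, b)} : Finset Cell) = insert (UR (a, b)) {R (a, b), (a, b)} from rfl,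
    perim_insert_of_contacts_eq_two h2n h2c, show ({R (a, b), (a, b)} : Finset Cell) = insert (R (a, b)) {(a, b)} from rfl,
    perim_insert_of_contacts_eq_one h1n h1c, perim_singleton]

/-- `perim F₂ = perim C₂ + 2`. [cite: MadrasSlade1993, §3.2, Theorem 3.2.3 (3.2.3)] -/
theorem perim_F2_eq_perim_chain3_add_two (p : Cell) :
    perim ({UL (UR p), UR p, R p, p} : Finset Cell) = perim ({UR (UR p), UR p, p} : Finset Cell) + 2 := by
  rw [perim_F2, perim_chain3]

/-- ★ The port of the top of `C₂` in `F₂`: `UR (UL (UR p)) = (p.x + 1, p.y + 3)` is a clean leaf spot of `F₂`.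
[cite: MadrasSlade1993, §3.2 (proof of Theorem 3.2.3)] -/
theorem card_contacts_portF2 (p : Cell) :
    UR (UL (UR p)) ∉ ({UL (UR p), UR p, R p, p} : Finset Cell) ∧ #(nbrs (UR (UL (UR p))) ∩ {UL (UR p), UR p, R p, p}) = 1 := by
  obtain ⟨a, b⟩ := p
  refine ⟨by simp only [mem_insert, mem_singleton, Prod.ext_iff, UR_fst, UR_snd, UL_fst, UL_snd, R_fst, R_snd]; omega, ?_⟩
  refine card_contacts_eq_one_of (d := UL (UR (a, b))) (by simp)
    (by simp only [mem_nbrs_iff, Prod.ext_iff, UR_fst, UR_snd, UL_fst, UL_snd]; omega) ?_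
  intro e he hen
  simp only [mem_insert, mem_singleton] at he
  simp only [mem_nbrs_iff, Prod.ext_iff, UL_fst, UL_snd, UR_fst, UR_snd] at hen
  rcases he with rfl | rfl | rfl | rfl
  · rfl
  · exfalso; simp only [UR_fst, UR_snd] at hen; omega
  · exfalso; simp only [R_fst, R_snd] at hen; omega
  · exfalso; omega

end HexCell

end Literature.Probability.RandomPlanarGeometry.SAW
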